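import Mathlib

/-!
# Orbit cancellation for flip-invariant signs (stub `stub_orbitCancel`)

The stub `stub_orbitCancel` of the crux `MobiusLadder.QuadraticDigitPhases`
(stmt-QuantumAdvantage-1391), line `Sketch`.  Mathlib only; purely combinatorial.

Setting: a finite "good" set `Good ⊆ Ω`, a family of flips `σ j : Ω → Ω` (`j : Fin d`) preserving
`Good` and involutive on it, signs `ρ j : Ω → ℝ` taking the values `±1` on `Good` and invariant
under every flip, and a phase `ε : Ω → ℝ` with `ε (σ j ω) = ρ j ω * ε ω` on `Good`.

Claim: `∑_{Good} ε = ∑_{Good ∩ {∀ j, ρ j = 1}} ε`.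

Proof: on the complement `B := Good ∩ {¬ ∀ j, ρ j = 1}` pick, for each `ω`, an index `j(ω)` with
`ρ_{j(ω)} ω ≠ 1` by `Classical.choose`; the choice depends only on the predicate
`j ↦ (ρ j ω ≠ 1)`, which is flip-invariant, so `τ ω := σ_{j(ω)} ω` is an involution of `B` with
`ε (τ ω) = -ε ω`, and `Finset.sum_involution` gives `∑_B ε = 0`.
-/

set_option linter.dupNamespace false -- D-0017: single-problem summit ⇒ `QuantumAdvantage.QuantumAdvantage` by design

namespace Summit.QuantumAdvantage.QuantumAdvantage.Theorems.MobiusLadderQuadraticDigitPhasesStubOrbitCancel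

open Finset

/-- `Classical.choose` depends on the predicate only up to pointwise equivalence. -/
theorem choose_congr {α : Sort*} {p q : α → Prop} (hp : ∃ a, p a) (hq : ∃ a, q a)
    (h : ∀ a, p a ↔ q a) : Classical.choose hp = Classical.choose hq := by
  obtain rfl : p = q := funext fun a => propext (h a)
  rfl

/-- **Sign cancellation.** On the part of `Good` where some sign `ρ j` is not `+1` (hence `-1`),
the phases cancel in pairs `ω ↔ σ j ω`, with `j = j(ω)` a choice depending only on the
flip-invariant predicate `j ↦ ρ j ω ≠ 1`. -/
theorem sum_filter_not_forall_eq_zero {Ω : Type*} {d : ℕ} (σ : Fin d → Ω → Ω)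
    (ρ : Fin d → Ω → ℝ) (Good : Finset Ω) (ε : Ω → ℝ)
    (hσGood : ∀ j, ∀ ω ∈ Good, σ j ω ∈ Good) (hσinv : ∀ j, ∀ ω ∈ Good, σ j (σ j ω) = ω)
    (hρ : ∀ j, ∀ ω ∈ Good, ρ j ω = 1 ∨ ρ j ω = -1)
    (hρinv : ∀ i j, ∀ ω ∈ Good, ρ i (σ j ω) = ρ i ω)
    (hε : ∀ j, ∀ ω ∈ Good, ε (σ j ω) = ρ j ω * ε ω) :
    ∑ ω ∈ Good.filter (fun ω => ¬ ∀ j, ρ j ω = 1), ε ω = 0 := by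
  set B := Good.filter (fun ω => ¬ ∀ j, ρ j ω = 1)
  -- a bad index exists on `B`
  have aux : ∀ ω ∈ B, ∃ j, ρ j ω ≠ 1 := fun ω hω => not_forall.mp (mem_filter.mp hω).2
  -- at the chosen bad index the sign is `-1`
  have hneg : ∀ ω (hω : ω ∈ B), ρ (Classical.choose (aux ω hω)) ω = -1 := fun ω hω =>
    (hρ _ ω (mem_filter.mp hω).1).resolve_left (Classical.choose_spec (aux ω hω))
  -- the flip at the chosen index stays in `B`
  have gmem : ∀ ω (hω : ω ∈ B), σ (Classical.choose (aux ω hω)) ω ∈ B := by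
    intro ω hω
    have hG := (mem_filter.mp hω).1
    refine mem_filter.mpr ⟨hσGood _ ω hG, fun hall => ?_⟩
    have h1 := hall (Classical.choose (aux ω hω))
    rw [hρinv _ _ ω hG, hneg ω hω] at h1
    norm_num at h1
  refine sum_involution (fun ω hω => σ (Classical.choose (aux ω hω)) ω) ?_ ?_ gmem ?_
  · intro ω hω
    rw [hε _ ω (mem_filter.mp hω).1, hneg ω hω]
    ring
  · intro ω hω hne hfix
    apply hne
    have h1 := hε (Classical.choose (aux ω hω)) ω (mem_filter.mp hω).1
    rw [hfix, hneg ω hω] at h1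
    linarith
  · intro ω hω
    have hG := (mem_filter.mp hω).1
    have hj : Classical.choose (aux _ (gmem ω hω)) = Classical.choose (aux ω hω) :=
      choose_congr _ _ (fun i => by rw [hρinv i _ ω hG])
    rw [hj]
    exact hσinv _ ω hG

/-- **Orbit cancellation.** With flips `σ j` preserving `Good` and involutive on it, signs
`ρ j = ±1` on `Good` invariant under all flips, and `ε ∘ σ j = ρ j • ε` on `Good`, the sum of `ε`
over `Good` only sees the inputs where every sign is `+1`: the rest cancels along flip pairs. -/
theorem stub_orbitCancel :
    ∀ (Ω : Type) [Fintype Ω] [DecidableEq Ω] (d : ℕ) (σ : Fin d → Ω → Ω) (ρ : Fin d → Ω → ℝ)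
      (Good : Finset Ω) (ε : Ω → ℝ),
      (∀ j, ∀ ω ∈ Good, σ j ω ∈ Good) → (∀ j, ∀ ω ∈ Good, σ j (σ j ω) = ω) →
      (∀ j, ∀ ω ∈ Good, ρ j ω = 1 ∨ ρ j ω = -1) → (∀ i j, ∀ ω ∈ Good, ρ i (σ j ω) = ρ i ω) →
      (∀ j, ∀ ω ∈ Good, ε (σ j ω) = ρ j ω * ε ω) →
      ∑ ω ∈ Good, ε ω = ∑ ω ∈ Good.filter (fun ω => ∀ j, ρ j ω = 1), ε ω := by
  intro Ω _ _ d σ ρ Good ε hσGood hσinv hρ hρinv hε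
  rw [← sum_filter_add_sum_filter_not Good (fun ω => ∀ j, ρ j ω = 1) ε,
    sum_filter_not_forall_eq_zero σ ρ Good ε hσGood hσinv hρ hρinv hε, add_zero]

end Summit.QuantumAdvantage.QuantumAdvantage.Theorems.MobiusLadderQuadraticDigitPhasesStubOrbitCancel
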